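import Mathlib.Data.Nat.Bitwise
import Mathlib.Data.Matrix.Mul
import Literature.InformationTheory.QuantumCodes.SymplecticCodes
import HarnessLib

/-!
# Packed bit representation of `𝔽₂ⁿ` and of the symplectic space `Ē = 𝔽₂ⁿ × 𝔽₂ⁿ`

Venture QEC (cell `qec`), checker-side plumbing (PARTITION row 01 "packed representation for
checkers: `ofBits`, `Fin n → ·` ↔ bitmask `Nat` with `testBit`, weight = popcount"; v2 D2.4: the
checker works on `Fin n`/bitmask encodings + an equivalence lemma — this file IS that lemma set;
venture artefact, hence under `Summits/Ventures/QEC/Census/` next to the checker): a binary word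
`v : Fin n → ZMod 2` is stored as the numeral `w = Σᵢ vᵢ 2ⁱ` (bit `i` of `w` = coordinate `i`), a Pauli
operator modulo phase `(a|b) : SympVec n` as the pair of numerals of `a` and `b` — the rows of the
binary check matrix `(A|B)` of Gottesman 1997 §3.4 / the `(a|b)` of Calderbank–Rains–Shor–Sloane
1998 §2 written in base 2. Everything here is elementary ("folklore"); the point is that the
right-hand sides (`bitCount`, `Nat.testBit`, `^^^`, `&&&`, `|||`) are what a kernel-evaluated checker
computes, while the left-hand sides (`hammingNorm`, `dotProduct`, `+`, `sympWeight`, `sympInner`,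
`Matrix.mulVec`) are what the definitions of distance speak about.

* `ofBits n w : Fin n → ZMod 2`, `toBits : (Fin n → ZMod 2) → ℕ` (inverse on `w < 2ⁿ`),
  `bitCount n w` (number of ones among the `n` low bits, structurally recursive in `n`);
* `ofBits_xor` (xor = addition), `hammingNorm_ofBits` (weight = `bitCount`), `dotProduct_ofBits`
  (`𝔽₂` inner product = parity of `bitCount (a &&& b)`), `ofBits_inj` / `ofBits_toBits` /
  `toBits_ofBits` (bijection with `[0, 2ⁿ)`);
* `ofBitRows n rows : Matrix (Fin m) (Fin n) (ZMod 2)` (a check matrix from a family of row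
  numerals) with `mulVec_ofBitRows_eq_zero_iff` (zero syndrome ↔ every row has even overlap),
  `ofBitRows_mul_transpose_eq_zero_iff` (`H_X H_Zᵀ = 0` ↔ all row overlaps even) and
  `ofBits_xorRows_eq_vecMul` (xor of selected rows = a row-space combination);
* `ofBitPair n xs zs = (ofBits n xs | ofBits n zs) : SympVec n` with `sympWeight_ofBitPair`
  (`= bitCount n (xs ||| zs)`) and `sympInner_ofBitPair` (`= bitCount (xs &&& zs') + bitCount (xs' &&& zs)`
  in `𝔽₂`).

The same one-line formula `fun i => if w.testBit i then 1 else 0` appears as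
`Literature.InformationTheory.Coding.GolayCode.ofBits` (with `GolayCode.popc`) inside
`ExtendedGolayCode.lean`; that file imports all of Mathlib and keeps its bit lemmas `private`, so the
API is restated here with light imports for the checkers' import closure. No instances, no notation.
-/

namespace Summit.Ventures.QEC

open Literature.InformationTheory.QuantumCodes Matrix Finset

/-! ### Words of numerals -/

/-- The word of a binary numeral: `(ofBits n w) i = 1` if bit `i` of `w` is set, else `0` (bits
`≥ n` are ignored). Column: definition. [folklore] -/
def ofBits (n : ℕ) (w : ℕ) : Fin n → ZMod 2 := fun i => if w.testBit i then 1 else 0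

variable {n : ℕ}

/-- Unfolding of `ofBits`. [folklore] -/
theorem ofBits_apply (w : ℕ) (i : Fin n) : ofBits n w i = if w.testBit i then 1 else 0 := rfl

/-- `(ofBits n w) i ≠ 0 ↔` bit `i` of `w` is set. [folklore] -/
theorem ofBits_apply_ne_zero_iff (w : ℕ) (i : Fin n) : ofBits n w i ≠ 0 ↔ w.testBit i = true := by
  rw [ofBits_apply]
  cases w.testBit i <;> decide

/-- `(ofBits n w) i = 0 ↔` bit `i` of `w` is clear. [folklore] -/
theorem ofBits_apply_eq_zero_iff (w : ℕ) (i : Fin n) : ofBits n w i = 0 ↔ w.testBit i = false := by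
  rw [ofBits_apply]
  cases w.testBit i <;> decide

/-- `ofBits n 0 = 0`. [folklore] -/
@[simp] theorem ofBits_zero (n : ℕ) : ofBits n 0 = 0 :=
  funext fun i => by rw [ofBits_apply, Nat.zero_testBit]; rfl

/-- **xor of numerals is addition of words** (the checker's row operation). Column: proved. [folklore] -/
theorem ofBits_xor (n a b : ℕ) : ofBits n (a ^^^ b) = ofBits n a + ofBits n b := by
  funext i
  simp only [ofBits_apply, Nat.testBit_xor, Pi.add_apply]
  cases a.testBit i <;> cases b.testBit i <;> decide

/-- Only the `n` low bits matter: `ofBits n (w % 2ⁿ) = ofBits n w`. [folklore] -/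
theorem ofBits_mod_two_pow (n w : ℕ) : ofBits n (w % 2 ^ n) = ofBits n w := by
  funext i
  simp only [ofBits_apply, Nat.testBit_mod_two_pow, i.is_lt, decide_true, Bool.true_and]

/-- `ofBits n` is injective on numerals `< 2ⁿ`. Column: proved. [folklore] -/
theorem ofBits_inj {n a b : ℕ} (ha : a < 2 ^ n) (hb : b < 2 ^ n) (h : ofBits n a = ofBits n b) :
    a = b := by
  refine Nat.eq_of_testBit_eq fun i => ?_
  by_cases hi : i < n
  · have h' := congrFun h ⟨i, hi⟩
    simp only [ofBits_apply] at h'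
    cases ha' : a.testBit i <;> cases hb' : b.testBit i
    · rfl
    · rw [ha', hb'] at h'; exact absurd h' (by decide)
    · rw [ha', hb'] at h'; exact absurd h' (by decide)
    · rfl
  · rw [not_lt] at hi
    rw [Nat.testBit_lt_two_pow (lt_of_lt_of_le ha (Nat.pow_le_pow_right (by norm_num) hi)),
      Nat.testBit_lt_two_pow (lt_of_lt_of_le hb (Nat.pow_le_pow_right (by norm_num) hi))]

/-! ### Numerals of words -/

/-- The numeral `Σᵢ vᵢ 2ⁱ` of a binary word (inverse of `ofBits n` on `[0, 2ⁿ)`), by recursion on the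
length: `toBits (v₀, v') = v₀ + 2 · toBits v'`. Column: definition. [folklore] -/
def toBits : {n : ℕ} → (Fin n → ZMod 2) → ℕ
  | 0, _ => 0
  | _ + 1, v => (v 0).val + 2 * toBits (fun i => v i.succ)

/-- `toBits v < 2ⁿ`. [folklore] -/
theorem toBits_lt : ∀ {n : ℕ} (v : Fin n → ZMod 2), toBits v < 2 ^ n
  | 0, _ => by simp [toBits]
  | n + 1, v => by
    have h := toBits_lt (fun i => v i.succ)
    have hv : (v 0).val < 2 := (v 0).val_lt
    rw [toBits, pow_succ]
    omega

/-- Bit `i` of `toBits v` is `[vᵢ ≠ 0]` (and `0` beyond `n`). [folklore] -/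
theorem testBit_toBits : ∀ {n : ℕ} (v : Fin n → ZMod 2) (i : ℕ),
    (toBits v).testBit i = if h : i < n then decide (v ⟨i, h⟩ ≠ 0) else false
  | 0, _, i => by simp [toBits]
  | n + 1, v, 0 => by
    have hv : ∀ c : ZMod 2, decide ((c.val + 2 * toBits (fun i : Fin n => v i.succ)) % 2 = 1)
        = decide (c ≠ 0) := by
      intro c; fin_cases c <;> simp [Nat.add_mul_mod_self_left] <;> decide
    rw [toBits, Nat.testBit_zero, dif_pos (Nat.succ_pos n)]
    exact hv (v 0)
  | n + 1, v, i + 1 => by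
    have hdiv : ((v 0).val + 2 * toBits (fun i : Fin n => v i.succ)) / 2
        = toBits (fun i : Fin n => v i.succ) := by
      have := (v 0).val_lt; omega
    rw [toBits, Nat.testBit_succ, hdiv, testBit_toBits]
    by_cases h : i < n
    · rw [dif_pos h, dif_pos (Nat.succ_lt_succ h)]; rfl
    · rw [dif_neg h, dif_neg (fun h' => h (Nat.lt_of_succ_lt_succ h'))]

/-- `ofBits n (toBits v) = v`: every word is the word of its numeral. Column: proved. [folklore] -/
theorem ofBits_toBits (v : Fin n → ZMod 2) : ofBits n (toBits v) = v := by
  funext i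
  rw [ofBits_apply, testBit_toBits, dif_pos i.is_lt]
  have : ∀ c : ZMod 2, (if decide (c ≠ 0) = true then (1 : ZMod 2) else 0) = c := by decide
  exact this (v i)

/-- `toBits (ofBits n w) = w` for `w < 2ⁿ`. Column: proved. [folklore] -/
theorem toBits_ofBits {w : ℕ} (hw : w < 2 ^ n) : toBits (ofBits n w) = w :=
  ofBits_inj (toBits_lt _) hw (ofBits_toBits _)

/-- Every word is `ofBits n w` for a unique `w < 2ⁿ` (surjectivity half). [folklore] -/
theorem exists_ofBits_eq (v : Fin n → ZMod 2) : ∃ w < 2 ^ n, ofBits n w = v :=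
  ⟨toBits v, toBits_lt v, ofBits_toBits v⟩

/-! ### Bit count = Hamming weight; overlap parity = inner product -/

/-- The number of ones among the `n` low bits of `w` (popcount), structurally recursive in `n`:
`bitCount (n+1) w = w % 2 + bitCount n (w / 2)`. Column: definition. [folklore] -/
def bitCount : ℕ → ℕ → ℕ
  | 0, _ => 0
  | n + 1, w => w % 2 + bitCount n (w / 2)

/-- `bitCount n w = Σ_{i < n} [bit i of w]`. [folklore] -/
theorem bitCount_eq_sum (n w : ℕ) : bitCount n w = ∑ i : Fin n, (w.testBit i).toNat := by
  induction n generalizing w with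
  | zero => simp [bitCount]
  | succ n ih =>
    rw [bitCount, ih (w / 2), Fin.sum_univ_succ]
    simp only [Fin.val_zero, Nat.testBit_zero, Fin.val_succ, Nat.testBit_succ]
    rcases Nat.mod_two_eq_zero_or_one w with h | h <;> simp [h]

/-- `bitCount n w = #{i < n | bit i of w}`. [folklore] -/
theorem bitCount_eq_card (n w : ℕ) : bitCount n w = #{i : Fin n | w.testBit i = true} := by
  rw [bitCount_eq_sum, Finset.card_filter]
  exact Finset.sum_congr rfl fun i _ => by cases w.testBit i <;> rfl

/-- `bitCount n w ≤ n`. [folklore] -/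
theorem bitCount_le (n w : ℕ) : bitCount n w ≤ n := by
  rw [bitCount_eq_card]
  exact (card_le_univ _).trans (by simp)

/-- **Hamming weight = bit count**: `wt (ofBits n w) = bitCount n w`. Column: proved. [folklore] -/
theorem hammingNorm_ofBits (n w : ℕ) : hammingNorm (ofBits n w) = bitCount n w := by
  rw [hammingNorm, bitCount_eq_card]
  congr 1
  ext i
  simp only [mem_filter, mem_univ, true_and, ofBits_apply_ne_zero_iff]

/-- **`𝔽₂` inner product = parity of the overlap count**: `ofBits n a · ofBits n b = bitCount n (a AND b)`
read in `𝔽₂`. Column: proved. [folklore] -/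
theorem dotProduct_ofBits (n a b : ℕ) :
    ofBits n a ⬝ᵥ ofBits n b = (bitCount n (a &&& b) : ZMod 2) := by
  rw [dotProduct, bitCount_eq_sum, Nat.cast_sum]
  refine Finset.sum_congr rfl fun i _ => ?_
  simp only [ofBits_apply, Nat.testBit_land]
  cases a.testBit i <;> cases b.testBit i <;> simp

/-- `ofBits n a · ofBits n b = 0 ↔ bitCount n (a AND b)` is even. [folklore] -/
theorem dotProduct_ofBits_eq_zero_iff (n a b : ℕ) :
    ofBits n a ⬝ᵥ ofBits n b = 0 ↔ bitCount n (a &&& b) % 2 = 0 := by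
  rw [dotProduct_ofBits, ZMod.natCast_eq_zero_iff, Nat.dvd_iff_mod_eq_zero]

/-! ### Check matrices from families of row numerals -/

/-- The binary matrix whose `r`-th row is the word of the numeral `rows r` (a checker holding a
`List`/`Array` of row numerals passes `fun r => rows[r]`). Column: definition. [folklore] -/
def ofBitRows (n : ℕ) {m : ℕ} (rows : Fin m → ℕ) : Matrix (Fin m) (Fin n) (ZMod 2) :=
  Matrix.of fun r i => ofBits n (rows r) i

variable {m : ℕ}

/-- Row `r` of `ofBitRows n rows` is `ofBits n (rows r)`. [folklore] -/
theorem ofBitRows_apply (rows : Fin m → ℕ) (r : Fin m) : ofBitRows n rows r = ofBits n (rows r) := rfl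

/-- The syndrome of the word of `w`: entry `r` is the overlap parity `bitCount n (rows r AND w)`.
[folklore] -/
theorem mulVec_ofBitRows_ofBits (rows : Fin m → ℕ) (w : ℕ) (r : Fin m) :
    (ofBitRows n rows *ᵥ ofBits n w) r = (bitCount n (rows r &&& w) : ZMod 2) := by
  rw [Matrix.mulVec, ofBitRows_apply, dotProduct_ofBits]

/-- **Zero syndrome ↔ every row has even overlap**: `H · (ofBits n w) = 0` iff
`bitCount n (row AND w)` is even for each row numeral — the test a checker runs. Column: proved.
[folklore] -/
theorem mulVec_ofBitRows_eq_zero_iff (rows : Fin m → ℕ) (w : ℕ) :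
    ofBitRows n rows *ᵥ ofBits n w = 0 ↔ ∀ r : Fin m, bitCount n (rows r &&& w) % 2 = 0 := by
  simp only [funext_iff, Pi.zero_apply, mulVec_ofBitRows_ofBits, ZMod.natCast_eq_zero_iff,
    Nat.dvd_iff_mod_eq_zero]

/-- Entries of `H_X H_Zᵀ` on numerals: `(H_X H_Zᵀ)_{rs}` is the overlap parity of row `r` of `H_X`
and row `s` of `H_Z`. [folklore] -/
theorem ofBitRows_mul_transpose_apply {m' : ℕ} (hx : Fin m → ℕ) (hz : Fin m' → ℕ) (r : Fin m)
    (s : Fin m') :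
    (ofBitRows n hx * (ofBitRows n hz)ᵀ) r s = (bitCount n (hx r &&& hz s) : ZMod 2) := by
  rw [Matrix.mul_apply', ← dotProduct_ofBits]
  rfl

/-- **CSS commutation check on numerals**: `H_X H_Zᵀ = 0` iff every pair (row of `H_X`, row of
`H_Z`) has even overlap. Column: proved.
[cite: Gottesman1997, §3.3 ("iff the rows of P and Q are orthogonal using the binary dot product")] -/
theorem ofBitRows_mul_transpose_eq_zero_iff {m' : ℕ} (hx : Fin m → ℕ) (hz : Fin m' → ℕ) :
    ofBitRows n hx * (ofBitRows n hz)ᵀ = 0 ↔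
      ∀ (r : Fin m) (s : Fin m'), bitCount n (hx r &&& hz s) % 2 = 0 := by
  simp only [← Matrix.ext_iff, Matrix.zero_apply, ofBitRows_mul_transpose_apply,
    ZMod.natCast_eq_zero_iff, Nat.dvd_iff_mod_eq_zero]

/-- The xor of the rows selected by the bits of the coefficient numeral `c` (bit `r` = coefficient of
row `r`), by recursion on the number of rows. Column: definition. [folklore] -/
def xorRows : {m : ℕ} → (Fin m → ℕ) → ℕ → ℕ
  | 0, _, _ => 0
  | _ + 1, rows, c => (if c.testBit 0 then rows 0 else 0) ^^^ xorRows (fun r => rows r.succ) (c / 2)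

/-- The word of `xorRows rows c` is the `𝔽₂`-combination `Σ_r c_r · (row r)`. Column: proved. [folklore] -/
theorem ofBits_xorRows : ∀ {m : ℕ} (rows : Fin m → ℕ) (c : ℕ),
    ofBits n (xorRows rows c) = ∑ r : Fin m, ofBits m c r • ofBits n (rows r)
  | 0, _, c => by simp [xorRows]
  | m + 1, rows, c => by
    rw [xorRows, ofBits_xor, ofBits_xorRows (fun r => rows r.succ) (c / 2), Fin.sum_univ_succ]
    congr 1
    · have h0 : ofBits (m + 1) c 0 = if c.testBit 0 then 1 else 0 := rfl
      rw [h0]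
      cases c.testBit 0 <;> simp
    · refine Finset.sum_congr rfl fun i _ => ?_
      have hs : ofBits (m + 1) c i.succ = ofBits m (c / 2) i := by
        simp only [ofBits_apply, Fin.val_succ, Nat.testBit_succ]
      rw [hs]

/-- Hence `ofBits n (xorRows rows c) = (ofBits m c) ᵥ* H` lies in the row space of
`H = ofBitRows n rows` (row-combination witnesses of a certificate). Column: proved. [folklore] -/
theorem ofBits_xorRows_eq_vecMul (rows : Fin m → ℕ) (c : ℕ) :
    ofBits n (xorRows rows c) = ofBits m c ᵥ* ofBitRows n rows := by
  rw [ofBits_xorRows]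
  funext i
  simp only [Finset.sum_apply, Pi.smul_apply, smul_eq_mul, Matrix.vecMul, dotProduct,
    ofBitRows_apply]

/-! ### The symplectic pair -/

/-- The Pauli operator modulo phase with `X`-numeral `xs` and `Z`-numeral `zs`:
`(ofBits n xs | ofBits n zs) ∈ Ē` — a row `(A|B)` of the binary check matrix in base 2.
Column: definition. [cite: Gottesman1997, §3.4 (binary matrix (A|B) of a stabilizer)] -/
def ofBitPair (n : ℕ) (xs zs : ℕ) : SympVec n := (ofBits n xs, ofBits n zs)

/-- Components of `ofBitPair`. [folklore] -/
@[simp] theorem ofBitPair_fst (n xs zs : ℕ) : (ofBitPair n xs zs).1 = ofBits n xs := rfl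

/-- Components of `ofBitPair`. [folklore] -/
@[simp] theorem ofBitPair_snd (n xs zs : ℕ) : (ofBitPair n xs zs).2 = ofBits n zs := rfl

/-- Product modulo phase = componentwise xor. Column: proved.
[cite: Gottesman1997, §3.4 ("Multiplication of group elements corresponds to addition of the corresponding binary vectors")] -/
theorem ofBitPair_xor (n xs zs xs' zs' : ℕ) :
    ofBitPair n (xs ^^^ xs') (zs ^^^ zs') = ofBitPair n xs zs + ofBitPair n xs' zs' :=
  Prod.ext (ofBits_xor n xs xs') (ofBits_xor n zs zs')

/-- **Weight = bit count of `xs OR zs`**: the symplectic weight of `(ofBits xs | ofBits zs)` is the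
number of positions where either numeral has a bit. Column: proved.
[cite: CalderbankEtAl1998, §2 (printed p. 4: weight of (a|b) = number of i with aᵢ = 1 or bᵢ = 1)] -/
theorem sympWeight_ofBitPair (n xs zs : ℕ) :
    sympWeight (ofBitPair n xs zs) = bitCount n (xs ||| zs) := by
  rw [sympWeight, bitCount_eq_card]
  congr 1
  ext i
  simp only [mem_filter, mem_univ, true_and, ofBitPair_fst, ofBitPair_snd,
    ofBits_apply_ne_zero_iff, Nat.testBit_lor, Bool.or_eq_true]

/-- **Symplectic inner product = parity of `bitCount (xs AND zs') + bitCount (xs' AND zs)`**.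
Column: proved. [cite: CalderbankEtAl1998, §2 eq. (1) (printed p. 4)] [cite: Gottesman1997, §3.4 (Q(a|b, c|d) = Σ (aᵢdᵢ + bᵢcᵢ))] -/
theorem sympInner_ofBitPair (n xs zs xs' zs' : ℕ) :
    sympInner (ofBitPair n xs zs) (ofBitPair n xs' zs') =
      (bitCount n (xs &&& zs') : ZMod 2) + (bitCount n (xs' &&& zs) : ZMod 2) := by
  rw [sympInner, ofBitPair_fst, ofBitPair_snd, ofBitPair_fst, ofBitPair_snd,
    dotProduct_ofBits, dotProduct_ofBits]

/-- Commutation test on numerals: the two operators commute (symplectic inner product `0`) iff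
`bitCount n (xs AND zs') + bitCount n (xs' AND zs)` is even. Column: proved.
[cite: Gottesman1997, §3.4 ("the condition that two operators commute … becomes the condition that the following inner product is 0")] -/
theorem sympInner_ofBitPair_eq_zero_iff (n xs zs xs' zs' : ℕ) :
    sympInner (ofBitPair n xs zs) (ofBitPair n xs' zs') = 0 ↔
      (bitCount n (xs &&& zs') + bitCount n (xs' &&& zs)) % 2 = 0 := by
  rw [sympInner_ofBitPair, ← Nat.cast_add, ZMod.natCast_eq_zero_iff, Nat.dvd_iff_mod_eq_zero]

end Summit.Ventures.QEC
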